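import Literature.Analysis.FluidPDE.KatoUniquenessDual
import Literature.Analysis.FluidPDE.NSWeakStrongUniquenessProofs
import HarnessLib

/-!
# The smallness estimate of the duality pairing for two `L³` mild solutions

Analysis/FluidPDE support file for the uniqueness theorem of Furioli–Lemarié-Rieusset–Terraneo
(`Literature.Analysis.FluidPDE.kato_unique`), third step of the `L²`-duality proof of the local forward-uniqueness
fact `Fluid.IsMildNSSolutionOn.ae_eq_Ico_of_ae_eq_Icc_three` (Lemarié-Rieusset 2016, Thm. 7.7,
after Monniaux and Lions–Masmoudi). Starting from the duality identity of
`KatoUniquenessDual.lean`,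
`∫_{(τ₀,τ₁]} ∫⟪w, Θ⟫ = ∫_{(τ₀,τ₁]} ∫ (⟪w, D𝒰[Θ] u⟫ + ⟪v, D𝒰[Θ] w⟫)`, `w = u - v`, the main
result `Fluid.IsMildNSSolutionOn.enorm_slab_duality_le` bounds, in dimension `3`,

  `|∫_{(τ₀,τ₁]} ∫⟪w, Θ⟫| ≤ (2ε nC_S (n/ν²)^{1/2} + 2λ (2(τ₁-τ₀)/ν)^{1/2})
      ‖w‖_{L²((τ₀,τ₁]×E)} ‖Θ‖_{L²((τ₀,τ₁]×E)}`

for any height `λ` with `‖1_{|u|≥λ} u(τ)‖_{L³}, ‖1_{|v|≥λ} v(τ)‖_{L³} ≤ ε` on `[τ₀, τ₁]`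
(`C_S` Mathlib's Gagliardo–Nirenberg–Sobolev constant). Ingredients:

* `Fluid.lintegral_enorm_transport_split_le`: the pointwise-in-time trilinear estimate with
  height truncation `u = 1_{|u|≥λ}u + u²`, `|u²| ≤ λ`:
  `∫|⟪w, L u⟫ + ⟪v, L w⟫| ≤ ‖w‖₂ (‖Φ‖₆ (‖u¹‖₃ + ‖v¹‖₃) + 2λ‖Φ‖₂)`, `Φ = √|L|²`;
* `Fluid.IsSpaceTimeTestOn.setLIntegral_frobenius_fderiv_heatDuhamelBack_le` and
  `…setLIntegral_sum_frobenius_fderiv_fderiv_heatDuhamelBack_le`: the energy and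
  maximal-regularity bounds of `HeatDuhamelEnergy.lean` in `ℝ≥0∞` form
  (`∫‖D𝒰‖₂² ≤ 2(τ₁-τ₀)/ν ‖Θ‖²`, `∫ ∑ᵢ‖D∂ᵢ𝒰‖₂² ≤ n/ν² ‖Θ‖²`);
* `Fluid.IsSpaceTimeTestOn.eLpNorm_six_sqrt_frobenius_fderiv_heatDuhamelBack_le`: the Sobolev
  bound `‖√|D𝒰(τ)|²‖₆ ≤ nC_S (∑ᵢ ∫|D∂ᵢ𝒰(τ)|²)^{1/2}` (`H¹(ℝ³) ⊂ L⁶(ℝ³)`,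
  accepted `eLpNorm_six_le_frobenius_of_hasWeakGradient`).

## References

* P. G. Lemarié-Rieusset, *The Navier–Stokes problem in the 21st century*, CRC Press 2016,
  Thm. 7.7 and its proof (third–fifth steps), pp. 147–149; Prop. 4.3, p. 62.
  [cite: LemarieRieusset2016, Thm. 7.7]
* G. Furioli, P. G. Lemarié-Rieusset, E. Terraneo, *Unicité dans `L³(ℝ³)` et d'autres espaces
  fonctionnels limites pour Navier–Stokes*, Rev. Mat. Iberoam. 16 (2000), Thm. 1.
  [cite: FurioliLemarieRieussetTerraneo2000, Thm. 1]
* J. C. Robinson, J. L. Rodrigo, W. Sadowski, *The three-dimensional Navier–Stokes equations*,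
  CUP 2016, Thm. 1.7 (i) (Sobolev embedding). [cite: RobinsonRodrigoSadowski2016, Thm. 1.7 (i)]
-/

noncomputable section

open MeasureTheory TopologicalSpace Set Function Filter Topology InnerProductSpace
open scoped RealInnerProductSpace ENNReal NNReal

namespace Literature.Analysis.FluidPDE

variable {E : Type*} [NormedAddCommGroup E] [InnerProductSpace ℝ E] [FiniteDimensional ℝ E]
  [MeasurableSpace E] [BorelSpace E]

/-! ### Pointwise tools -/

section Pointwise

omit [FiniteDimensional ℝ E] [MeasurableSpace E] [BorelSpace E] in
/-- `‖⟪a, c⟫‖ₑ ≤ ‖a‖ₑ ‖c‖ₑ` (Cauchy–Schwarz in `ℝ≥0∞`). [folklore] -/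
theorem enorm_inner_le_mul (a c : E) : ‖⟪a, c⟫‖ₑ ≤ ‖a‖ₑ * ‖c‖ₑ := by
  have h := nnnorm_inner_le_nnnorm (𝕜 := ℝ) a c
  calc ‖⟪a, c⟫‖ₑ = ((‖⟪a, c⟫‖₊ : ℝ≥0) : ℝ≥0∞) := rfl
    _ ≤ ((‖a‖₊ * ‖c‖₊ : ℝ≥0) : ℝ≥0∞) := ENNReal.coe_le_coe.2 h
    _ = ‖a‖ₑ * ‖c‖ₑ := by rw [ENNReal.coe_mul]; rfl

omit [MeasurableSpace E] [BorelSpace E] in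
/-- The `ℝ≥0∞`-norm of the Frobenius modulus `x ↦ (|L|²)^{1/2}`:
`‖√|L|²‖ₑ = ofReal(|L|²)^{1/2}`. [folklore] -/
theorem enorm_sqrt_frobeniusNormSq (L : E →L[ℝ] E) :
    ‖Real.sqrt (frobeniusNormSq L)‖ₑ = ENNReal.ofReal (frobeniusNormSq L) ^ (1 / 2 : ℝ) := by
  rw [Real.enorm_eq_ofReal (Real.sqrt_nonneg _), Real.sqrt_eq_rpow,
    ENNReal.ofReal_rpow_of_nonneg (frobeniusNormSq_nonneg L) (by norm_num)]

omit [MeasurableSpace E] [BorelSpace E] in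
/-- `‖L b‖ₑ ≤ ‖√|L|²‖ₑ ‖b‖ₑ` (operator norm ≤ Frobenius norm). [folklore] -/
theorem enorm_apply_le_enorm_sqrt_frobenius_mul (L : E →L[ℝ] E) (b : E) :
    ‖L b‖ₑ ≤ ‖Real.sqrt (frobeniusNormSq L)‖ₑ * ‖b‖ₑ := by
  rw [enorm_sqrt_frobeniusNormSq]
  exact FluidPDE.enorm_apply_le_frobenius_mul L b

omit [MeasurableSpace E] [BorelSpace E] in
/-- The Frobenius modulus of an operator field depends continuously on the operator. [folklore] -/
theorem continuous_sqrt_frobeniusNormSq :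
    Continuous fun L : E →L[ℝ] E => Real.sqrt (frobeniusNormSq L) := by
  refine Real.continuous_sqrt.comp ?_
  unfold frobeniusNormSq
  fun_prop

omit [InnerProductSpace ℝ E] [FiniteDimensional ℝ E] [MeasurableSpace E] [BorelSpace E] in
/-- **Height truncation**: the low part `u - 1_{|u| ≥ λ} u` is bounded by `λ`. [folklore] -/
theorem enorm_sub_indicator_le (u : E → E) (lam : ℝ≥0) (x : E) :
    ‖u x - {y | lam ≤ ‖u y‖₊}.indicator u x‖ₑ ≤ lam := by
  by_cases h : lam ≤ ‖u x‖₊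
  · rw [indicator_of_mem (show x ∈ {y | lam ≤ ‖u y‖₊} from h), sub_self, enorm_zero]
    exact zero_le
  · rw [indicator_of_notMem (show x ∉ {y | lam ≤ ‖u y‖₊} from h), sub_zero]
    exact ENNReal.coe_le_coe.2 (not_le.1 h).le

end Pointwise

/-! ### The pointwise-in-time trilinear estimate with height truncation -/

section FixedTime

/-- **Trilinear estimate with height truncation at a fixed time** (Lemarié-Rieusset 2016, proof
of Thm. 7.7, third step: split `u = u¹ + u²` with `u¹ = 1_{|u|≥λ} u` small in `L³` and
`|u²| ≤ λ`). For fields `w ∈ L²`, `u`, `v` and an operator field `L` with Frobenius modulus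
`Φ = √|L|²`:
`∫ |⟪w, L u⟫ + ⟪v, L w⟫| ≤ ‖w‖₂ (‖Φ‖₆ (‖u¹‖₃ + ‖v¹‖₃) + 2λ ‖Φ‖₂)`
(Hölder `(2,6,3)` on the high parts, Cauchy–Schwarz on the low parts).
[cite: LemarieRieusset2016, proof of Thm. 7.7, third and fifth steps, pp. 148–149] -/
theorem lintegral_enorm_transport_split_le {w u v : E → E} {L : E → E →L[ℝ] E}
    (hw : AEStronglyMeasurable w (volume : Measure E))
    (hu : AEStronglyMeasurable u (volume : Measure E))
    (hv : AEStronglyMeasurable v (volume : Measure E))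
    (hL : AEStronglyMeasurable L (volume : Measure E)) (lam : ℝ≥0) :
    ∫⁻ x, ‖⟪w x, L x (u x)⟫ + ⟪v x, L x (w x)⟫‖ₑ ≤
      eLpNorm w 2 volume *
        (eLpNorm (fun x => Real.sqrt (frobeniusNormSq (L x))) 6 volume *
            (eLpNorm ({y | lam ≤ ‖u y‖₊}.indicator u) 3 volume +
              eLpNorm ({y | lam ≤ ‖v y‖₊}.indicator v) 3 volume) +
          2 * lam * eLpNorm (fun x => Real.sqrt (frobeniusNormSq (L x))) 2 volume) := by
  set Φ : E → ℝ := fun x => Real.sqrt (frobeniusNormSq (L x)) with hΦ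
  set u1 : E → E := {y | lam ≤ ‖u y‖₊}.indicator u with hu1
  set v1 : E → E := {y | lam ≤ ‖v y‖₊}.indicator v with hv1
  -- measurability
  have hΦm : AEStronglyMeasurable Φ volume := continuous_sqrt_frobeniusNormSq.comp_aestronglyMeasurable hL
  have htrunc : Measurable fun z : E => if lam ≤ ‖z‖₊ then z else 0 :=
    Measurable.ite (measurableSet_le measurable_const measurable_nnnorm) measurable_id
      measurable_const
  have hu1m : AEStronglyMeasurable u1 volume := by
    have h : u1 = (fun z : E => if lam ≤ ‖z‖₊ then z else 0) ∘ u := by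
      funext y; by_cases hy : lam ≤ ‖u y‖₊ <;> simp [hu1, hy]
    rw [h]
    exact (htrunc.comp_aemeasurable hu.aemeasurable).aestronglyMeasurable
  have hv1m : AEStronglyMeasurable v1 volume := by
    have h : v1 = (fun z : E => if lam ≤ ‖z‖₊ then z else 0) ∘ v := by
      funext y; by_cases hy : lam ≤ ‖v y‖₊ <;> simp [hv1, hy]
    rw [h]
    exact (htrunc.comp_aemeasurable hv.aemeasurable).aestronglyMeasurable
  -- pointwise splitting bound
  have key : ∀ x, ‖⟪w x, L x (u x)⟫ + ⟪v x, L x (w x)⟫‖ₑ ≤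
      ‖w x‖ₑ * ‖Φ x‖ₑ * ‖u1 x‖ₑ + ‖v1 x‖ₑ * ‖Φ x‖ₑ * ‖w x‖ₑ +
        2 * lam * (‖w x‖ₑ * ‖Φ x‖ₑ) := by
    intro x
    have hsplit : ⟪w x, L x (u x)⟫ + ⟪v x, L x (w x)⟫ =
        (⟪w x, L x (u1 x)⟫ + ⟪w x, L x (u x - u1 x)⟫) +
          (⟪v1 x, L x (w x)⟫ + ⟪v x - v1 x, L x (w x)⟫) := by
      simp only [map_sub, inner_sub_right, inner_sub_left]; ring
    rw [hsplit]
    have hF : ∀ b, ‖L x b‖ₑ ≤ ‖Φ x‖ₑ * ‖b‖ₑ := fun b =>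
      enorm_apply_le_enorm_sqrt_frobenius_mul (L x) b
    have h1 : ‖⟪w x, L x (u1 x)⟫‖ₑ ≤ ‖w x‖ₑ * ‖Φ x‖ₑ * ‖u1 x‖ₑ := by
      calc ‖⟪w x, L x (u1 x)⟫‖ₑ ≤ ‖w x‖ₑ * ‖L x (u1 x)‖ₑ := enorm_inner_le_mul _ _
        _ ≤ ‖w x‖ₑ * (‖Φ x‖ₑ * ‖u1 x‖ₑ) := by gcongr; exact hF _
        _ = ‖w x‖ₑ * ‖Φ x‖ₑ * ‖u1 x‖ₑ := by ring
    have h2 : ‖⟪w x, L x (u x - u1 x)⟫‖ₑ ≤ lam * (‖w x‖ₑ * ‖Φ x‖ₑ) := by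
      calc ‖⟪w x, L x (u x - u1 x)⟫‖ₑ ≤ ‖w x‖ₑ * ‖L x (u x - u1 x)‖ₑ := enorm_inner_le_mul _ _
        _ ≤ ‖w x‖ₑ * (‖Φ x‖ₑ * ‖u x - u1 x‖ₑ) := by gcongr; exact hF _
        _ ≤ ‖w x‖ₑ * (‖Φ x‖ₑ * lam) := by gcongr; exact enorm_sub_indicator_le u lam x
        _ = lam * (‖w x‖ₑ * ‖Φ x‖ₑ) := by ring
    have h3 : ‖⟪v1 x, L x (w x)⟫‖ₑ ≤ ‖v1 x‖ₑ * ‖Φ x‖ₑ * ‖w x‖ₑ := by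
      calc ‖⟪v1 x, L x (w x)⟫‖ₑ ≤ ‖v1 x‖ₑ * ‖L x (w x)‖ₑ := enorm_inner_le_mul _ _
        _ ≤ ‖v1 x‖ₑ * (‖Φ x‖ₑ * ‖w x‖ₑ) := by gcongr; exact hF _
        _ = ‖v1 x‖ₑ * ‖Φ x‖ₑ * ‖w x‖ₑ := by ring
    have h4 : ‖⟪v x - v1 x, L x (w x)⟫‖ₑ ≤ lam * (‖w x‖ₑ * ‖Φ x‖ₑ) := by
      calc ‖⟪v x - v1 x, L x (w x)⟫‖ₑ ≤ ‖v x - v1 x‖ₑ * ‖L x (w x)‖ₑ := enorm_inner_le_mul _ _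
        _ ≤ lam * (‖Φ x‖ₑ * ‖w x‖ₑ) := by
            gcongr
            · exact enorm_sub_indicator_le v lam x
            · exact hF _
        _ = lam * (‖w x‖ₑ * ‖Φ x‖ₑ) := by ring
    calc ‖(⟪w x, L x (u1 x)⟫ + ⟪w x, L x (u x - u1 x)⟫) +
          (⟪v1 x, L x (w x)⟫ + ⟪v x - v1 x, L x (w x)⟫)‖ₑ
        ≤ (‖⟪w x, L x (u1 x)⟫‖ₑ + ‖⟪w x, L x (u x - u1 x)⟫‖ₑ) +
          (‖⟪v1 x, L x (w x)⟫‖ₑ + ‖⟪v x - v1 x, L x (w x)⟫‖ₑ) :=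
          (enorm_add_le _ _).trans (add_le_add (enorm_add_le _ _) (enorm_add_le _ _))
      _ ≤ (‖w x‖ₑ * ‖Φ x‖ₑ * ‖u1 x‖ₑ + lam * (‖w x‖ₑ * ‖Φ x‖ₑ)) +
          (‖v1 x‖ₑ * ‖Φ x‖ₑ * ‖w x‖ₑ + lam * (‖w x‖ₑ * ‖Φ x‖ₑ)) :=
          add_le_add (add_le_add h1 h2) (add_le_add h3 h4)
      _ = ‖w x‖ₑ * ‖Φ x‖ₑ * ‖u1 x‖ₑ + ‖v1 x‖ₑ * ‖Φ x‖ₑ * ‖w x‖ₑ +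
          2 * lam * (‖w x‖ₑ * ‖Φ x‖ₑ) := by ring
  -- Hölder bounds of the three pieces
  have H1 : ∫⁻ x, ‖w x‖ₑ * ‖Φ x‖ₑ * ‖u1 x‖ₑ ≤
      eLpNorm w 2 volume * eLpNorm Φ 6 volume * eLpNorm u1 3 volume := by
    have h := lintegral_enorm_mul_mul_le (μ := (volume : Measure E)) hw hΦm hu1m
      (p := 2) (q := 6) (r := 3) (by norm_num) (by norm_num) (by norm_num) (by norm_num)
    simpa only [ENNReal.ofReal_ofNat] using h
  have H3 : ∫⁻ x, ‖v1 x‖ₑ * ‖Φ x‖ₑ * ‖w x‖ₑ ≤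
      eLpNorm v1 3 volume * eLpNorm Φ 6 volume * eLpNorm w 2 volume := by
    have h := lintegral_enorm_mul_mul_le (μ := (volume : Measure E)) hv1m hΦm hw
      (p := 3) (q := 6) (r := 2) (by norm_num) (by norm_num) (by norm_num) (by norm_num)
    simpa only [ENNReal.ofReal_ofNat] using h
  have H2 : ∫⁻ x, ‖w x‖ₑ * ‖Φ x‖ₑ ≤ eLpNorm w 2 volume * eLpNorm Φ 2 volume := by
    have h := ENNReal.lintegral_mul_le_Lp_mul_Lq (volume : Measure E) Real.HolderConjugate.two_two
      hw.enorm hΦm.enorm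
    rw [eLpNorm_eq_lintegral_rpow_enorm_toReal two_ne_zero ENNReal.ofNat_ne_top,
      eLpNorm_eq_lintegral_rpow_enorm_toReal two_ne_zero ENNReal.ofNat_ne_top, ENNReal.toReal_ofNat]
    simpa only [Pi.mul_apply] using h
  have hlam : (2 : ℝ≥0∞) * lam ≠ ⊤ := ENNReal.mul_ne_top ENNReal.ofNat_ne_top ENNReal.coe_ne_top
  have m1 : AEMeasurable (fun x => ‖w x‖ₑ * ‖Φ x‖ₑ * ‖u1 x‖ₑ) volume :=
    (hw.enorm.mul hΦm.enorm).mul hu1m.enorm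
  have m3 : AEMeasurable (fun x => ‖v1 x‖ₑ * ‖Φ x‖ₑ * ‖w x‖ₑ) volume :=
    (hv1m.enorm.mul hΦm.enorm).mul hw.enorm
  have m13 : AEMeasurable
      (fun x => ‖w x‖ₑ * ‖Φ x‖ₑ * ‖u1 x‖ₑ + ‖v1 x‖ₑ * ‖Φ x‖ₑ * ‖w x‖ₑ) volume := m1.add m3
  calc ∫⁻ x, ‖⟪w x, L x (u x)⟫ + ⟪v x, L x (w x)⟫‖ₑ
      ≤ ∫⁻ x, (‖w x‖ₑ * ‖Φ x‖ₑ * ‖u1 x‖ₑ + ‖v1 x‖ₑ * ‖Φ x‖ₑ * ‖w x‖ₑ +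
          2 * lam * (‖w x‖ₑ * ‖Φ x‖ₑ)) := lintegral_mono key
    _ = (∫⁻ x, ‖w x‖ₑ * ‖Φ x‖ₑ * ‖u1 x‖ₑ) + (∫⁻ x, ‖v1 x‖ₑ * ‖Φ x‖ₑ * ‖w x‖ₑ) +
          2 * lam * ∫⁻ x, ‖w x‖ₑ * ‖Φ x‖ₑ := by
        rw [lintegral_add_left' m13, lintegral_add_left' m1, lintegral_const_mul' _ _ hlam]
    _ ≤ eLpNorm w 2 volume * eLpNorm Φ 6 volume * eLpNorm u1 3 volume +
          eLpNorm v1 3 volume * eLpNorm Φ 6 volume * eLpNorm w 2 volume +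
          2 * lam * (eLpNorm w 2 volume * eLpNorm Φ 2 volume) :=
        add_le_add (add_le_add H1 H3) (mul_le_mul_right H2 _)
    _ = eLpNorm w 2 volume * (eLpNorm Φ 6 volume * (eLpNorm u1 3 volume + eLpNorm v1 3 volume) +
          2 * lam * eLpNorm Φ 2 volume) := by ring

end FixedTime

/-! ### The dual field `𝒰[Θ]`: Frobenius modulus of the gradient, energy and Sobolev bounds -/

section DualField

variable {ν : ℝ} {Θ : ℝ → E → E}

omit [MeasurableSpace E] [BorelSpace E] in
/-- `‖a‖ₑ² = ofReal (‖a‖²)`. [folklore] -/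
theorem enorm_rpow_two_eq_ofReal_sq {F : Type*} [NormedAddCommGroup F] (a : F) :
    ‖a‖ₑ ^ (2 : ℝ) = ENNReal.ofReal (‖a‖ ^ 2) := by
  rw [← ofReal_norm, ENNReal.ofReal_rpow_of_nonneg (norm_nonneg _) zero_le_two, Real.rpow_two]

/-- **Joint continuity of the gradient of the dual field** `(τ, x) ↦ D𝒰[Θ](τ)(x)`
(`= 𝒰[DΘ](τ)(x)`, `continuous_heatDuhamelBack`). [folklore] -/
theorem IsSpaceTimeTestOn.continuous_fderiv_heatDuhamelBack_uncurry
    (hΘ : IsSpaceTimeTestOn (⊤ : Opens (ℝ × E)) Θ) (hν : 0 < ν) :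
    Continuous fun q : ℝ × E => fderiv ℝ (heatDuhamelBack ν Θ q.1) q.2 := by
  have h := hΘ.fderiv_top.continuous_heatDuhamelBack hν
  refine h.congr fun q => ?_
  simp only [hΘ.fderiv_heatDuhamelBack hν q.1]

/-- **Slab `L²` mass of a Duhamel field in `ℝ≥0∞`**: for a space-time test field `Ψ` and
`τ₀ ≤ τ₁`, `∫⁻_{(τ₀,τ₁]} ∫⁻ ‖𝒰[Ψ](τ)(x)‖ₑ² = ofReal (∫_{τ₀}^{τ₁} ∫ ‖𝒰[Ψ](s)(x)‖² dx ds)`, and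
the slice energy is interval integrable (Tonelli/Fubini on the accepted
`integrable_prod_sq_norm_heatDuhamelBack`). [folklore] -/
theorem IsSpaceTimeTestOn.setLIntegral_lintegral_enorm_sq_heatDuhamelBack
    {Ψ : ℝ → E → E} (hΨ : IsSpaceTimeTestOn (⊤ : Opens (ℝ × E)) Ψ) (hν : 0 < ν) {τ₀ τ₁ : ℝ}
    (hτ : τ₀ ≤ τ₁) :
    (∫⁻ τ in Ioc τ₀ τ₁, ∫⁻ x, ‖heatDuhamelBack ν Ψ τ x‖ₑ ^ (2 : ℝ)) =
        ENNReal.ofReal (∫ s in τ₀..τ₁, ∫ x, ‖heatDuhamelBack ν Ψ s x‖ ^ 2) ∧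
      IntervalIntegrable (fun s => ∫ x, ‖heatDuhamelBack ν Ψ s x‖ ^ 2) volume τ₀ τ₁ := by
  have hI := hΨ.integrable_prod_sq_norm_heatDuhamelBack hν τ₀ τ₁
  refine ⟨?_, (intervalIntegrable_iff_integrableOn_Ioc_of_le hτ).2 hI.integral_prod_right⟩
  have hmeas : AEMeasurable (fun q : E × ℝ => ENNReal.ofReal (‖heatDuhamelBack ν Ψ q.2 q.1‖ ^ 2))
      ((volume : Measure E).prod (volume.restrict (Ioc τ₀ τ₁))) :=
    hI.1.aemeasurable.ennreal_ofReal
  simp_rw [enorm_rpow_two_eq_ofReal_sq]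
  rw [← lintegral_prod_symm _ hmeas, ← ofReal_integral_eq_lintegral_ofReal hI
    (Eventually.of_forall fun _ => sq_nonneg _), integral_prod_symm _ hI,
    intervalIntegral.integral_of_le hτ]

/-- **Energy bound of the gradient of the dual field in `ℝ≥0∞`**: with
`D(τ) = ∫⁻ ofReal |D𝒰[Θ](τ)|²` (Frobenius density),
`∫⁻_{(τ₀,τ₁]} D(τ) ≤ ofReal (2(τ₁-τ₀)/ν · Q)`, `Q = ∫_{τ₀}^{τ₁} ∫ ‖Θ‖²`
(accepted `energy_estimate_zero`, Lemarié-Rieusset 2016, Prop. 4.3 (B)).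
[cite: LemarieRieusset2016, Prop. 4.3 (B) p. 62] -/
theorem IsSpaceTimeTestOn.setLIntegral_frobenius_fderiv_heatDuhamelBack_le
    (hΘ : IsSpaceTimeTestOn (⊤ : Opens (ℝ × E)) Θ) (hν : 0 < ν) {a b : ℝ}
    (hab : ∀ t, t ∉ Icc a b → Θ t = 0) {τ₀ τ₁ : ℝ} (hτ : τ₀ ≤ τ₁) (hb : b ≤ τ₁) :
    (∫⁻ τ in Ioc τ₀ τ₁, ∫⁻ x,
        ENNReal.ofReal (frobeniusNormSq (fderiv ℝ (heatDuhamelBack ν Θ τ) x))) ≤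
      ENNReal.ofReal (2 * (τ₁ - τ₀) / ν * ∫ s in τ₀..τ₁, ∫ x, ‖Θ s x‖ ^ 2) := by
  have hΘi : ∀ i, IsSpaceTimeTestOn (⊤ : Opens (ℝ × E))
      (fun t y => fderiv ℝ (Θ t) y (stdOrthonormalBasis ℝ E i)) :=
    fun i => hΘ.fderiv_apply_top (stdOrthonormalBasis ℝ E i)
  have hUi : ∀ i τ x, fderiv ℝ (heatDuhamelBack ν Θ τ) x (stdOrthonormalBasis ℝ E i) =
      heatDuhamelBack ν (fun t y => fderiv ℝ (Θ t) y (stdOrthonormalBasis ℝ E i)) τ x :=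
    fun i τ x => hΘ.fderiv_heatDuhamelBack_apply hν τ x (stdOrthonormalBasis ℝ E i)
  have hE := (hΘ.energy_estimate_zero hν hab hτ hb).2
  have hmi : ∀ i, Measurable fun q : ℝ × E =>
      ‖heatDuhamelBack ν (fun t y => fderiv ℝ (Θ t) y (stdOrthonormalBasis ℝ E i)) q.1 q.2‖ₑ ^
        (2 : ℝ) := fun i =>
    ((hΘi i).continuous_heatDuhamelBack hν).measurable.enorm.pow_const _
  -- rewrite the Frobenius density as a sum over the frame
  have hpt : ∀ τ, (∫⁻ x, ENNReal.ofReal (frobeniusNormSq (fderiv ℝ (heatDuhamelBack ν Θ τ) x))) =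
      ∑ i, ∫⁻ x, ‖heatDuhamelBack ν
        (fun t y => fderiv ℝ (Θ t) y (stdOrthonormalBasis ℝ E i)) τ x‖ₑ ^ (2 : ℝ) := by
    intro τ
    rw [← lintegral_finsetSum' _ fun i _ =>
      (((hΘi i).continuous_heatDuhamelBack_space hν τ).measurable.enorm.pow_const _).aemeasurable]
    refine lintegral_congr fun x => ?_
    rw [ofReal_frobeniusNormSq_eq_sum]
    simp only [hUi]
  simp_rw [hpt]
  rw [lintegral_finsetSum' _ fun i _ => ((hmi i).lintegral_prod_right').aemeasurable]
  have h2 : ∀ i, (∫⁻ τ in Ioc τ₀ τ₁, ∫⁻ x, ‖heatDuhamelBack ν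
      (fun t y => fderiv ℝ (Θ t) y (stdOrthonormalBasis ℝ E i)) τ x‖ₑ ^ (2 : ℝ)) =
      ENNReal.ofReal (∫ s in τ₀..τ₁, ∫ x, ‖heatDuhamelBack ν
        (fun t y => fderiv ℝ (Θ t) y (stdOrthonormalBasis ℝ E i)) s x‖ ^ 2) :=
    fun i => ((hΘi i).setLIntegral_lintegral_enorm_sq_heatDuhamelBack hν hτ).1
  simp_rw [h2]
  rw [← ENNReal.ofReal_sum_of_nonneg fun i _ => intervalIntegral.integral_nonneg hτ
    fun s _ => integral_nonneg fun x => sq_nonneg _]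
  refine ENNReal.ofReal_le_ofReal ?_
  rw [← intervalIntegral.integral_finsetSum fun i _ =>
    ((hΘi i).setLIntegral_lintegral_enorm_sq_heatDuhamelBack hν hτ).2]
  simpa only [hUi] using hE

/-- **Maximal-regularity bound of the Hessian of the dual field in `ℝ≥0∞`**: with
`D₂(τ) = ∑ᵢ ∫⁻ ofReal |D ∂ᵢ𝒰[Θ](τ)|²`,
`∫⁻_{(τ₀,τ₁]} D₂(τ) ≤ ofReal (n/ν² · Q)` (accepted `energy_estimate_one`,
Lemarié-Rieusset 2016, Prop. 4.3 (C) / Thm. 7.4). [cite: LemarieRieusset2016, Prop. 4.3 (C) p. 62] -/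
theorem IsSpaceTimeTestOn.setLIntegral_sum_frobenius_fderiv_fderiv_heatDuhamelBack_le
    (hΘ : IsSpaceTimeTestOn (⊤ : Opens (ℝ × E)) Θ) (hν : 0 < ν) {a b : ℝ}
    (hab : ∀ t, t ∉ Icc a b → Θ t = 0) {τ₀ τ₁ : ℝ} (hτ : τ₀ ≤ τ₁) (hb : b ≤ τ₁) :
    (∫⁻ τ in Ioc τ₀ τ₁, ∑ i, ∫⁻ x, ENNReal.ofReal (frobeniusNormSq
        (fderiv ℝ (fun y => fderiv ℝ (heatDuhamelBack ν Θ τ) y (stdOrthonormalBasis ℝ E i)) x))) ≤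
      ENNReal.ofReal ((Module.finrank ℝ E : ℝ) / ν ^ 2 * ∫ s in τ₀..τ₁, ∫ x, ‖Θ s x‖ ^ 2) := by
  have hΘi : ∀ i, IsSpaceTimeTestOn (⊤ : Opens (ℝ × E))
      (fun t y => fderiv ℝ (Θ t) y (stdOrthonormalBasis ℝ E i)) :=
    fun i => hΘ.fderiv_apply_top (stdOrthonormalBasis ℝ E i)
  have hΘij : ∀ i j, IsSpaceTimeTestOn (⊤ : Opens (ℝ × E))
      (fun t y => fderiv ℝ (fun z => fderiv ℝ (Θ t) z (stdOrthonormalBasis ℝ E i)) y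
        (stdOrthonormalBasis ℝ E j)) :=
    fun i j => (hΘi i).fderiv_apply_top (stdOrthonormalBasis ℝ E j)
  have hUi : ∀ i τ, (fun y => fderiv ℝ (heatDuhamelBack ν Θ τ) y (stdOrthonormalBasis ℝ E i)) =
      heatDuhamelBack ν (fun t y => fderiv ℝ (Θ t) y (stdOrthonormalBasis ℝ E i)) τ :=
    fun i τ => funext fun x => hΘ.fderiv_heatDuhamelBack_apply hν τ x (stdOrthonormalBasis ℝ E i)
  have hUij : ∀ i j τ x, fderiv ℝ (fun y => fderiv ℝ (heatDuhamelBack ν Θ τ) y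
      (stdOrthonormalBasis ℝ E i)) x (stdOrthonormalBasis ℝ E j) =
      heatDuhamelBack ν (fun t y => fderiv ℝ (fun z => fderiv ℝ (Θ t) z
        (stdOrthonormalBasis ℝ E i)) y (stdOrthonormalBasis ℝ E j)) τ x := by
    intro i j τ x
    rw [hUi i τ, (hΘi i).fderiv_heatDuhamelBack_apply hν τ x (stdOrthonormalBasis ℝ E j)]
  have hE := hΘ.energy_estimate_one hν hab hτ hb
  have hmij : ∀ i j, Measurable fun q : ℝ × E => ‖heatDuhamelBack ν
      (fun t y => fderiv ℝ (fun z => fderiv ℝ (Θ t) z (stdOrthonormalBasis ℝ E i)) y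
        (stdOrthonormalBasis ℝ E j)) q.1 q.2‖ₑ ^ (2 : ℝ) :=
    fun i j => ((hΘij i j).continuous_heatDuhamelBack hν).measurable.enorm.pow_const _
  have hinner : ∀ i τ, (∫⁻ x, ENNReal.ofReal (frobeniusNormSq
      (fderiv ℝ (fun y => fderiv ℝ (heatDuhamelBack ν Θ τ) y (stdOrthonormalBasis ℝ E i)) x))) =
      ∑ j, ∫⁻ x, ‖heatDuhamelBack ν
        (fun t y => fderiv ℝ (fun z => fderiv ℝ (Θ t) z (stdOrthonormalBasis ℝ E i)) y
          (stdOrthonormalBasis ℝ E j)) τ x‖ₑ ^ (2 : ℝ) := by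
    intro i τ
    rw [← lintegral_finsetSum' _ fun j _ =>
      (((hΘij i j).continuous_heatDuhamelBack_space hν τ).measurable.enorm.pow_const _).aemeasurable]
    refine lintegral_congr fun x => ?_
    rw [ofReal_frobeniusNormSq_eq_sum]
    simp only [hUij]
  simp_rw [hinner]
  rw [lintegral_finsetSum' _ fun i _ => Finset.aemeasurable_fun_sum _ fun j _ =>
    ((hmij i j).lintegral_prod_right').aemeasurable]
  have hsplit : ∀ i, (∫⁻ τ in Ioc τ₀ τ₁, ∑ j, ∫⁻ x, ‖heatDuhamelBack ν
      (fun t y => fderiv ℝ (fun z => fderiv ℝ (Θ t) z (stdOrthonormalBasis ℝ E i)) y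
        (stdOrthonormalBasis ℝ E j)) τ x‖ₑ ^ (2 : ℝ)) =
      ∑ j, ∫⁻ τ in Ioc τ₀ τ₁, ∫⁻ x, ‖heatDuhamelBack ν
        (fun t y => fderiv ℝ (fun z => fderiv ℝ (Θ t) z (stdOrthonormalBasis ℝ E i)) y
          (stdOrthonormalBasis ℝ E j)) τ x‖ₑ ^ (2 : ℝ) := fun i =>
    lintegral_finsetSum' _ fun j _ => ((hmij i j).lintegral_prod_right').aemeasurable
  simp_rw [hsplit]
  have h2 : ∀ i j, (∫⁻ τ in Ioc τ₀ τ₁, ∫⁻ x, ‖heatDuhamelBack ν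
      (fun t y => fderiv ℝ (fun z => fderiv ℝ (Θ t) z (stdOrthonormalBasis ℝ E i)) y
        (stdOrthonormalBasis ℝ E j)) τ x‖ₑ ^ (2 : ℝ)) =
      ENNReal.ofReal (∫ s in τ₀..τ₁, ∫ x, ‖heatDuhamelBack ν
        (fun t y => fderiv ℝ (fun z => fderiv ℝ (Θ t) z (stdOrthonormalBasis ℝ E i)) y
          (stdOrthonormalBasis ℝ E j)) s x‖ ^ 2) :=
    fun i j => ((hΘij i j).setLIntegral_lintegral_enorm_sq_heatDuhamelBack hν hτ).1
  simp_rw [h2]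
  have hnn : ∀ i j, 0 ≤ ∫ s in τ₀..τ₁, ∫ x, ‖heatDuhamelBack ν
      (fun t y => fderiv ℝ (fun z => fderiv ℝ (Θ t) z (stdOrthonormalBasis ℝ E i)) y
        (stdOrthonormalBasis ℝ E j)) s x‖ ^ 2 :=
    fun i j => intervalIntegral.integral_nonneg hτ fun s _ => integral_nonneg fun x => sq_nonneg _
  rw [← Finset.sum_congr rfl fun i _ => ENNReal.ofReal_sum_of_nonneg fun j _ => hnn i j,
    ← ENNReal.ofReal_sum_of_nonneg fun i _ => Finset.sum_nonneg fun j _ => hnn i j]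
  refine ENNReal.ofReal_le_ofReal ?_
  have h3 : ∀ i, ∑ j, (∫ s in τ₀..τ₁, ∫ x, ‖heatDuhamelBack ν
      (fun t y => fderiv ℝ (fun z => fderiv ℝ (Θ t) z (stdOrthonormalBasis ℝ E i)) y
        (stdOrthonormalBasis ℝ E j)) s x‖ ^ 2) =
      ∫ s in τ₀..τ₁, ∑ j, ∫ x, ‖heatDuhamelBack ν
        (fun t y => fderiv ℝ (fun z => fderiv ℝ (Θ t) z (stdOrthonormalBasis ℝ E i)) y
          (stdOrthonormalBasis ℝ E j)) s x‖ ^ 2 :=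
    fun i => (intervalIntegral.integral_finsetSum fun j _ =>
      ((hΘij i j).setLIntegral_lintegral_enorm_sq_heatDuhamelBack hν hτ).2).symm
  simp_rw [h3]
  have hIi : ∀ i, IntervalIntegrable (fun s => ∑ j, ∫ x, ‖heatDuhamelBack ν
      (fun t y => fderiv ℝ (fun z => fderiv ℝ (Θ t) z (stdOrthonormalBasis ℝ E i)) y
        (stdOrthonormalBasis ℝ E j)) s x‖ ^ 2) volume τ₀ τ₁ := fun i => by
    have h := IntervalIntegrable.sum Finset.univ fun j _ =>
      ((hΘij i j).setLIntegral_lintegral_enorm_sq_heatDuhamelBack hν hτ).2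
    have hfun : (∑ j ∈ Finset.univ, fun s => ∫ x, ‖heatDuhamelBack ν
        (fun t y => fderiv ℝ (fun z => fderiv ℝ (Θ t) z (stdOrthonormalBasis ℝ E i)) y
          (stdOrthonormalBasis ℝ E j)) s x‖ ^ 2) = fun s => ∑ j, ∫ x, ‖heatDuhamelBack ν
        (fun t y => fderiv ℝ (fun z => fderiv ℝ (Θ t) z (stdOrthonormalBasis ℝ E i)) y
          (stdOrthonormalBasis ℝ E j)) s x‖ ^ 2 := by
      funext s
      simp only [Finset.sum_apply]
    rw [hfun] at h
    exact h
  rw [← intervalIntegral.integral_finsetSum fun i _ => hIi i]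
  simpa only [hUij] using hE

end DualField


section DualFieldSobolev

variable {ν : ℝ} {Θ : ℝ → E → E}

/-- The `L²` norm of the Frobenius modulus `√|DU|²` is the square root of the Frobenius
dissipation: `‖√|DU|²‖_{L²} = (∫⁻ ofReal |DU|²)^{1/2}`. [folklore] -/
theorem eLpNorm_two_sqrt_frobeniusNormSq (G : E → E →L[ℝ] E) :
    eLpNorm (fun x => Real.sqrt (frobeniusNormSq (G x))) 2 (volume : Measure E) =
      (∫⁻ x, ENNReal.ofReal (frobeniusNormSq (G x))) ^ (1 / 2 : ℝ) := by
  rw [eLpNorm_eq_lintegral_rpow_enorm_toReal two_ne_zero ENNReal.ofNat_ne_top, ENNReal.toReal_ofNat]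
  congr 1
  refine lintegral_congr fun x => ?_
  rw [enorm_sqrt_frobeniusNormSq, ← ENNReal.rpow_mul]
  norm_num

/-- **Sobolev bound of the gradient of the dual field in `L⁶` (dimension `3`)**:
`‖√|D𝒰[Θ](τ)|²‖_{L⁶} ≤ n C_S (∑ᵢ ∫⁻ ofReal |D∂ᵢ𝒰[Θ](τ)|²)^{1/2}` with Mathlib's
Gagliardo–Nirenberg–Sobolev constant `C_S` (`√(∑ᵢ aᵢ²) ≤ ∑ᵢ aᵢ`, Minkowski, and
`H¹(ℝ³) ⊂ L⁶(ℝ³)` for each `∂ᵢ𝒰[Θ](τ) = 𝒰[∂ᵢΘ](τ) ∈ H¹`, accepted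
`eLpNorm_six_le_frobenius_of_hasWeakGradient`; Robinson–Rodrigo–Sadowski 2016, Thm. 1.7 (i)).
[cite: RobinsonRodrigoSadowski2016, Thm. 1.7 (i)] -/
theorem IsSpaceTimeTestOn.eLpNorm_six_sqrt_frobenius_fderiv_heatDuhamelBack_le
    (hd : Module.finrank ℝ E = 3) (hΘ : IsSpaceTimeTestOn (⊤ : Opens (ℝ × E)) Θ) (hν : 0 < ν)
    (τ : ℝ) :
    eLpNorm (fun x => Real.sqrt (frobeniusNormSq (fderiv ℝ (heatDuhamelBack ν Θ τ) x))) 6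
        (volume : Measure E) ≤
      (Module.finrank ℝ E : ℝ≥0∞) * (SNormLESNormFDerivOfEqConst E (volume : Measure E) 2 : ℝ≥0) *
        (∑ i, ∫⁻ x, ENNReal.ofReal (frobeniusNormSq (fderiv ℝ
          (fun y => fderiv ℝ (heatDuhamelBack ν Θ τ) y (stdOrthonormalBasis ℝ E i)) x))) ^
          (1 / 2 : ℝ) := by
  have hΘi : ∀ i, IsSpaceTimeTestOn (⊤ : Opens (ℝ × E))
      (fun t y => fderiv ℝ (Θ t) y (stdOrthonormalBasis ℝ E i)) :=
    fun i => hΘ.fderiv_apply_top (stdOrthonormalBasis ℝ E i)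
  have hUi : ∀ i, (fun y => fderiv ℝ (heatDuhamelBack ν Θ τ) y (stdOrthonormalBasis ℝ E i)) =
      heatDuhamelBack ν (fun t y => fderiv ℝ (Θ t) y (stdOrthonormalBasis ℝ E i)) τ :=
    fun i => funext fun x => hΘ.fderiv_heatDuhamelBack_apply hν τ x (stdOrthonormalBasis ℝ E i)
  -- Step 1: `√|L|² ≤ ∑ᵢ ‖L eᵢ‖`
  have hpt : ∀ x, ‖Real.sqrt (frobeniusNormSq (fderiv ℝ (heatDuhamelBack ν Θ τ) x))‖ ≤
      ‖∑ i, ‖fderiv ℝ (heatDuhamelBack ν Θ τ) x (stdOrthonormalBasis ℝ E i)‖‖ := by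
    intro x
    have hs : 0 ≤ ∑ i, ‖fderiv ℝ (heatDuhamelBack ν Θ τ) x (stdOrthonormalBasis ℝ E i)‖ :=
      Finset.sum_nonneg fun i _ => norm_nonneg _
    rw [Real.norm_of_nonneg (Real.sqrt_nonneg _), Real.norm_of_nonneg hs]
    calc Real.sqrt (frobeniusNormSq (fderiv ℝ (heatDuhamelBack ν Θ τ) x))
        ≤ Real.sqrt ((∑ i, ‖fderiv ℝ (heatDuhamelBack ν Θ τ) x (stdOrthonormalBasis ℝ E i)‖) ^ 2) :=
          Real.sqrt_le_sqrt (Finset.sum_sq_le_sq_sum_of_nonneg fun i _ => norm_nonneg _)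
      _ = ∑ i, ‖fderiv ℝ (heatDuhamelBack ν Θ τ) x (stdOrthonormalBasis ℝ E i)‖ := Real.sqrt_sq hs
  -- Step 2: Minkowski
  have hmeas : ∀ i, AEStronglyMeasurable
      (fun x => ‖fderiv ℝ (heatDuhamelBack ν Θ τ) x (stdOrthonormalBasis ℝ E i)‖)
      (volume : Measure E) := fun i => by
    have h := ((hΘi i).continuous_heatDuhamelBack_space hν τ).norm.aestronglyMeasurable
      (μ := (volume : Measure E))
    rw [← hUi i] at h
    exact h
  have h2 : eLpNorm (fun x => ∑ i, ‖fderiv ℝ (heatDuhamelBack ν Θ τ) x (stdOrthonormalBasis ℝ E i)‖)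
      6 (volume : Measure E) ≤
      ∑ i, eLpNorm (fun x => ‖fderiv ℝ (heatDuhamelBack ν Θ τ) x (stdOrthonormalBasis ℝ E i)‖)
        6 (volume : Measure E) := by
    have h := eLpNorm_sum_le (μ := (volume : Measure E)) (p := 6) (s := Finset.univ)
      (f := fun i x => ‖fderiv ℝ (heatDuhamelBack ν Θ τ) x (stdOrthonormalBasis ℝ E i)‖)
      (fun i _ => hmeas i) (by norm_num)
    have hfun : (∑ i ∈ Finset.univ, fun x =>
        ‖fderiv ℝ (heatDuhamelBack ν Θ τ) x (stdOrthonormalBasis ℝ E i)‖) =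
        fun x => ∑ i, ‖fderiv ℝ (heatDuhamelBack ν Θ τ) x (stdOrthonormalBasis ℝ E i)‖ := by
      funext x
      simp only [Finset.sum_apply]
    rw [hfun] at h
    exact h
  -- Step 3: Sobolev for each component
  have h3 : ∀ i, eLpNorm (fun x => ‖fderiv ℝ (heatDuhamelBack ν Θ τ) x (stdOrthonormalBasis ℝ E i)‖)
      6 (volume : Measure E) ≤
      (SNormLESNormFDerivOfEqConst E (volume : Measure E) 2 : ℝ≥0) *
        (∑ j, ∫⁻ x, ENNReal.ofReal (frobeniusNormSq (fderiv ℝ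
          (fun y => fderiv ℝ (heatDuhamelBack ν Θ τ) y (stdOrthonormalBasis ℝ E j)) x))) ^
          (1 / 2 : ℝ) := by
    intro i
    rw [eLpNorm_norm]
    have hC2 : ContDiff ℝ 1 (fun y => fderiv ℝ (heatDuhamelBack ν Θ τ) y (stdOrthonormalBasis ℝ E i)) := by
      rw [hUi i]
      exact ((hΘi i).contDiff_two_heatDuhamelBack hν τ).of_le one_le_two
    have hL2 : MemLp (fun y => fderiv ℝ (heatDuhamelBack ν Θ τ) y (stdOrthonormalBasis ℝ E i)) 2
        (volume : Measure E) := by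
      rw [hUi i]
      exact (hΘi i).memLp_two_heatDuhamelBack hν τ
    have hS := eLpNorm_six_le_frobenius_of_hasWeakGradient hd hL2
      (HasWeakGradient.of_contDiff_holds hC2)
    refine hS.trans ?_
    gcongr
    exact Finset.single_le_sum (f := fun j => ∫⁻ x, ENNReal.ofReal (frobeniusNormSq (fderiv ℝ
      (fun y => fderiv ℝ (heatDuhamelBack ν Θ τ) y (stdOrthonormalBasis ℝ E j)) x)))
      (fun j _ => zero_le) (Finset.mem_univ i)
  calc eLpNorm (fun x => Real.sqrt (frobeniusNormSq (fderiv ℝ (heatDuhamelBack ν Θ τ) x))) 6 volume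
      ≤ eLpNorm (fun x => ∑ i, ‖fderiv ℝ (heatDuhamelBack ν Θ τ) x (stdOrthonormalBasis ℝ E i)‖)
          6 (volume : Measure E) := eLpNorm_mono hpt
    _ ≤ ∑ i, eLpNorm (fun x => ‖fderiv ℝ (heatDuhamelBack ν Θ τ) x (stdOrthonormalBasis ℝ E i)‖)
          6 (volume : Measure E) := h2
    _ ≤ ∑ _i : Fin (Module.finrank ℝ E), (SNormLESNormFDerivOfEqConst E (volume : Measure E) 2 : ℝ≥0) *
          (∑ j, ∫⁻ x, ENNReal.ofReal (frobeniusNormSq (fderiv ℝ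
            (fun y => fderiv ℝ (heatDuhamelBack ν Θ τ) y (stdOrthonormalBasis ℝ E j)) x))) ^
            (1 / 2 : ℝ) := Finset.sum_le_sum fun i _ => h3 i
    _ = _ := by
        rw [Finset.sum_const, Finset.card_univ, Fintype.card_fin, nsmul_eq_mul]
        ring

end DualFieldSobolev


/-! ### The smallness estimate -/

section Estimate

variable {ν T : ℝ} {u v : ℝ → E → E} {u₀ : E → E} {Θ : ℝ → E → E}

/-- Measurability in `(τ, x)` of the Frobenius density of `D𝒰[Θ]` and of `D∂ᵢ𝒰[Θ]`, and the
measurability in `τ` of their `x`-integrals. [folklore] -/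
theorem IsSpaceTimeTestOn.measurable_lintegral_frobenius_fderiv_heatDuhamelBack
    (hΘ : IsSpaceTimeTestOn (⊤ : Opens (ℝ × E)) Θ) (hν : 0 < ν) :
    Measurable (fun τ => ∫⁻ x, ENNReal.ofReal (frobeniusNormSq
        (fderiv ℝ (heatDuhamelBack ν Θ τ) x)) ∂(volume : Measure E)) ∧
      Measurable (fun τ => ∑ i, ∫⁻ x, ENNReal.ofReal (frobeniusNormSq (fderiv ℝ
        (fun y => fderiv ℝ (heatDuhamelBack ν Θ τ) y (stdOrthonormalBasis ℝ E i)) x))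
          ∂(volume : Measure E)) := by
  have hfrob : Continuous fun L : E →L[ℝ] E => ENNReal.ofReal (frobeniusNormSq L) := by
    refine ENNReal.continuous_ofReal.comp ?_
    unfold frobeniusNormSq
    fun_prop
  constructor
  · exact (hfrob.comp (hΘ.continuous_fderiv_heatDuhamelBack_uncurry hν)).measurable
      |>.lintegral_prod_right'
  · refine Finset.measurable_sum _ fun i _ => ?_
    have hΘi : IsSpaceTimeTestOn (⊤ : Opens (ℝ × E))
        (fun t y => fderiv ℝ (Θ t) y (stdOrthonormalBasis ℝ E i)) :=
      hΘ.fderiv_apply_top (stdOrthonormalBasis ℝ E i)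
    have hUi : ∀ τ, (fun y => fderiv ℝ (heatDuhamelBack ν Θ τ) y (stdOrthonormalBasis ℝ E i)) =
        heatDuhamelBack ν (fun t y => fderiv ℝ (Θ t) y (stdOrthonormalBasis ℝ E i)) τ :=
      fun τ => funext fun x => hΘ.fderiv_heatDuhamelBack_apply hν τ x (stdOrthonormalBasis ℝ E i)
    have h := (hfrob.comp (hΘi.continuous_fderiv_heatDuhamelBack_uncurry hν)).measurable
      |>.lintegral_prod_right' (ν := (volume : Measure E))
    simp only [Function.comp_def] at h
    simpa only [hUi] using h

/-- Cauchy–Schwarz in time in the shape used below: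
`∫⁻ f · g^{1/2} ≤ (∫⁻ f²)^{1/2} (∫⁻ g)^{1/2}`. [folklore] -/
theorem lintegral_mul_rpow_half_le {α : Type*} [MeasurableSpace α] {μ : Measure α}
    {f g : α → ℝ≥0∞} (hf : AEMeasurable f μ) (hg : AEMeasurable g μ) :
    ∫⁻ a, f a * g a ^ (1 / 2 : ℝ) ∂μ ≤
      (∫⁻ a, f a ^ (2 : ℝ) ∂μ) ^ (1 / 2 : ℝ) * (∫⁻ a, g a ∂μ) ^ (1 / 2 : ℝ) := by
  have h := ENNReal.lintegral_mul_le_Lp_mul_Lq μ Real.HolderConjugate.two_two hf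
    (hg.pow_const (1 / 2 : ℝ))
  have hg2 : ∀ a, (g a ^ (1 / 2 : ℝ)) ^ (2 : ℝ) = g a := fun a => by
    rw [← ENNReal.rpow_mul]; norm_num
  simp only [Pi.mul_apply, hg2] at h
  simpa only [one_div] using h

/-- **The smallness estimate of the duality pairing** (Lemarié-Rieusset 2016, proof of Thm. 7.7,
third and fifth steps, in the `L²`-duality form of Monniaux's proof). In the setting of the
duality identity (`IsMildNSSolutionOn.slab_duality_split`: two unforced mild solutions `u`, `v`
on `[0, T)` agreeing on `[0, τ₀]`, bounded by `M` in `L³` on `[0, τ₁]`, a space-time test field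
`Θ` with divergence-free slices and time support `⊆ (-∞, τ₁]`), in dimension `3`, with a height
`λ` and the `L³`-size `ε` of the high parts `1_{|u|≥λ}u`, `1_{|v|≥λ}v` on `[τ₀, τ₁]`:
`|∫_{(τ₀,τ₁]} ∫⟪u - v, Θ⟫| ≤ (2ε · nC_S · (n/ν²)^{1/2} + 2λ (2(τ₁-τ₀)/ν)^{1/2}) ·
  ‖u - v‖_{L²((τ₀,τ₁] × E)} ‖Θ‖_{L²((τ₀,τ₁] × E)}`
(pointwise trilinear estimate with truncation, Cauchy–Schwarz in time, the energy bound
`∫‖D𝒰‖₂² ≤ 2(τ₁-τ₀)/ν ‖Θ‖²` and the maximal-regularity + Sobolev bound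
`∫‖D𝒰‖₆² ≤ n²C_S² n/ν² ‖Θ‖²`). [cite: LemarieRieusset2016, proof of Thm. 7.7, third–fifth steps, pp. 148–149] -/
theorem IsMildNSSolutionOn.enorm_slab_duality_le (hd : Module.finrank ℝ E = 3) (hν : 0 < ν)
    (hΘ : IsSpaceTimeTestOn (⊤ : Opens (ℝ × E)) Θ) (hΘd : ∀ t, VectorCalculus.IsDivFree (Θ t))
    (h₁ : IsMildNSSolutionOn (Ico 0 T) ν 0 u₀ u) (h₂ : IsMildNSSolutionOn (Ico 0 T) ν 0 u₀ v)
    (hmu : AEStronglyMeasurable (uncurry u)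
      ((volume : Measure (ℝ × E)).restrict (Ioo 0 T ×ˢ univ)))
    (hmv : AEStronglyMeasurable (uncurry v)
      ((volume : Measure (ℝ × E)).restrict (Ioo 0 T ×ˢ univ)))
    {τ₀ τ₁ : ℝ} (hτ₀ : 0 ≤ τ₀) (hτ : τ₀ ≤ τ₁) (hτ₁ : τ₁ < T) {M : ℝ≥0}
    (hu3 : ∀ τ ∈ Icc 0 τ₁, MemLp (u τ) 3 (volume : Measure E) ∧ eLpNorm (u τ) 3 volume ≤ M)
    (hv3 : ∀ τ ∈ Icc 0 τ₁, MemLp (v τ) 3 (volume : Measure E) ∧ eLpNorm (v τ) 3 volume ≤ M)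
    (hco : ∀ s ∈ Icc 0 τ₀, u s =ᵐ[volume] v s) {a b : ℝ} (hab : ∀ t, t ∉ Icc a b → Θ t = 0)
    (hb : b ≤ τ₁) {lam eps : ℝ≥0}
    (hut : ∀ τ ∈ Icc τ₀ τ₁, eLpNorm ({y | lam ≤ ‖u τ y‖₊}.indicator (u τ)) 3 volume ≤ eps)
    (hvt : ∀ τ ∈ Icc τ₀ τ₁, eLpNorm ({y | lam ≤ ‖v τ y‖₊}.indicator (v τ)) 3 volume ≤ eps) :
    ‖∫ t in Ioc τ₀ τ₁, ∫ x, ⟪u t x - v t x, Θ t x⟫‖ₑ ≤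
      (2 * eps * ((Module.finrank ℝ E : ℝ≥0∞) *
            (SNormLESNormFDerivOfEqConst E (volume : Measure E) 2 : ℝ≥0)) *
          ENNReal.ofReal ((Module.finrank ℝ E : ℝ) / ν ^ 2) ^ (1 / 2 : ℝ) +
        2 * lam * ENNReal.ofReal (2 * (τ₁ - τ₀) / ν) ^ (1 / 2 : ℝ)) *
      (∫⁻ τ in Ioc τ₀ τ₁, ∫⁻ x, ‖u τ x - v τ x‖ₑ ^ (2 : ℝ)) ^ (1 / 2 : ℝ) *
      ENNReal.ofReal (∫ s in τ₀..τ₁, ∫ x, ‖Θ s x‖ ^ 2) ^ (1 / 2 : ℝ) := by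
  have hQ0 : 0 ≤ ∫ s in τ₀..τ₁, ∫ x, ‖Θ s x‖ ^ 2 :=
    intervalIntegral.integral_nonneg hτ fun s _ => integral_nonneg fun x => sq_nonneg _
  -- Step 1: duality identity and the triangle inequality
  rw [h₁.slab_duality_split hν hΘ hΘd h₂ hmu hmv hτ₀ hτ hτ₁ hu3 hv3 hco hab hb]
  refine ((enorm_integral_le_lintegral_enorm _).trans
    (lintegral_mono fun τ => enorm_integral_le_lintegral_enorm _)).trans ?_
  -- Step 2: the pointwise-in-time estimate
  have hA : ∀ τ, eLpNorm (fun x => u τ x - v τ x) 2 (volume : Measure E) = (∫⁻ x, ‖u τ x - v τ x‖ₑ ^ (2 : ℝ)) ^ (1 / 2 : ℝ) := fun τ => by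
    rw [eLpNorm_eq_lintegral_rpow_enorm_toReal two_ne_zero ENNReal.ofNat_ne_top, ENNReal.toReal_ofNat]
  have step2 : (∫⁻ τ in Ioc τ₀ τ₁, ∫⁻ x, ‖⟪u τ x - v τ x, fderiv ℝ (heatDuhamelBack ν Θ τ) x (u τ x)⟫ + ⟪v τ x, fderiv ℝ (heatDuhamelBack ν Θ τ) x (u τ x - v τ x)⟫‖ₑ) ≤
      ∫⁻ τ in Ioc τ₀ τ₁, ((eps + eps) * ((Module.finrank ℝ E : ℝ≥0∞) * (SNormLESNormFDerivOfEqConst E (volume : Measure E) 2 : ℝ≥0)) * ((∫⁻ x, ‖u τ x - v τ x‖ₑ ^ (2 : ℝ)) ^ (1 / 2 : ℝ) * (∑ i, ∫⁻ x, ENNReal.ofReal (frobeniusNormSq (fderiv ℝ (fun y => fderiv ℝ (heatDuhamelBack ν Θ τ) y (stdOrthonormalBasis ℝ E i)) x))) ^ (1 / 2 : ℝ)) +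
        2 * lam * ((∫⁻ x, ‖u τ x - v τ x‖ₑ ^ (2 : ℝ)) ^ (1 / 2 : ℝ) * (∫⁻ x, ENNReal.ofReal (frobeniusNormSq (fderiv ℝ (heatDuhamelBack ν Θ τ) x))) ^ (1 / 2 : ℝ))) := by
    refine setLIntegral_mono' measurableSet_Ioc fun τ hτ' => ?_
    have hτI' : τ ∈ Icc τ₀ τ₁ := Ioc_subset_Icc_self hτ'
    have hτI : τ ∈ Icc 0 τ₁ := ⟨hτ₀.trans hτI'.1, hτI'.2⟩
    have hw : AEStronglyMeasurable (fun x => u τ x - v τ x) (volume : Measure E) :=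
      (hu3 τ hτI).1.1.sub (hv3 τ hτI).1.1
    have hL : AEStronglyMeasurable (fun x => fderiv ℝ (heatDuhamelBack ν Θ τ) x)
        (volume : Measure E) :=
      ((hΘ.continuous_fderiv_heatDuhamelBack_uncurry hν).comp
        (continuous_const.prodMk continuous_id)).aestronglyMeasurable
    have h := lintegral_enorm_transport_split_le (w := fun x => u τ x - v τ x)
      (L := fun x => fderiv ℝ (heatDuhamelBack ν Θ τ) x) hw (hu3 τ hτI).1.1 (hv3 τ hτI).1.1 hL lam
    refine h.trans ?_
    rw [hA τ, eLpNorm_two_sqrt_frobeniusNormSq]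
    have h6 := hΘ.eLpNorm_six_sqrt_frobenius_fderiv_heatDuhamelBack_le hd hν τ
    calc (∫⁻ x, ‖u τ x - v τ x‖ₑ ^ (2 : ℝ)) ^ (1 / 2 : ℝ) * (eLpNorm (fun x => Real.sqrt (frobeniusNormSq
          (fderiv ℝ (heatDuhamelBack ν Θ τ) x))) 6 volume *
          (eLpNorm ({y | lam ≤ ‖u τ y‖₊}.indicator (u τ)) 3 volume +
            eLpNorm ({y | lam ≤ ‖v τ y‖₊}.indicator (v τ)) 3 volume) +
          2 * lam * (∫⁻ x, ENNReal.ofReal (frobeniusNormSq (fderiv ℝ (heatDuhamelBack ν Θ τ) x))) ^ (1 / 2 : ℝ))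
        ≤ (∫⁻ x, ‖u τ x - v τ x‖ₑ ^ (2 : ℝ)) ^ (1 / 2 : ℝ) * (((Module.finrank ℝ E : ℝ≥0∞) * (SNormLESNormFDerivOfEqConst E (volume : Measure E) 2 : ℝ≥0)) * (∑ i, ∫⁻ x, ENNReal.ofReal (frobeniusNormSq (fderiv ℝ (fun y => fderiv ℝ (heatDuhamelBack ν Θ τ) y (stdOrthonormalBasis ℝ E i)) x))) ^ (1 / 2 : ℝ) * (eps + eps) + 2 * lam * (∫⁻ x, ENNReal.ofReal (frobeniusNormSq (fderiv ℝ (heatDuhamelBack ν Θ τ) x))) ^ (1 / 2 : ℝ)) := by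
          gcongr
          · exact hut τ hτI'
          · exact hvt τ hτI'
      _ = _ := by ring
  refine step2.trans ?_
  -- Step 3: split, Cauchy–Schwarz in time, energy and Sobolev bounds
  obtain ⟨hmD, hmD2⟩ := hΘ.measurable_lintegral_frobenius_fderiv_heatDuhamelBack hν
  have hmA : AEMeasurable (fun τ => (∫⁻ x, ‖u τ x - v τ x‖ₑ ^ (2 : ℝ)) ^ (1 / 2 : ℝ)) (volume.restrict (Ioc τ₀ τ₁)) := by
    have hw : AEStronglyMeasurable (fun q : ℝ × E => u q.1 q.2 - v q.1 q.2)
        ((volume.restrict (Ioc τ₀ τ₁)).prod (volume : Measure E)) :=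
      (aestronglyMeasurable_uncurry_restrict_Ioc hτ₀ hτ₁ hmu).sub
        (aestronglyMeasurable_uncurry_restrict_Ioc hτ₀ hτ₁ hmv)
    exact ((hw.enorm.pow_const (2 : ℝ)).lintegral_prod_right').pow_const _
  have hCSfin : (eps + eps : ℝ≥0∞) * ((Module.finrank ℝ E : ℝ≥0∞) * (SNormLESNormFDerivOfEqConst E (volume : Measure E) 2 : ℝ≥0)) ≠ ⊤ :=
    ENNReal.mul_ne_top (by simp) (ENNReal.mul_ne_top (ENNReal.natCast_ne_top _) ENNReal.coe_ne_top)
  have hlamfin : (2 : ℝ≥0∞) * lam ≠ ⊤ := ENNReal.mul_ne_top ENNReal.ofNat_ne_top ENNReal.coe_ne_top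
  have m1 : AEMeasurable (fun τ => (eps + eps : ℝ≥0∞) * ((Module.finrank ℝ E : ℝ≥0∞) * (SNormLESNormFDerivOfEqConst E (volume : Measure E) 2 : ℝ≥0)) * ((∫⁻ x, ‖u τ x - v τ x‖ₑ ^ (2 : ℝ)) ^ (1 / 2 : ℝ) * (∑ i, ∫⁻ x, ENNReal.ofReal (frobeniusNormSq (fderiv ℝ (fun y => fderiv ℝ (heatDuhamelBack ν Θ τ) y (stdOrthonormalBasis ℝ E i)) x))) ^ (1 / 2 : ℝ)))
      (volume.restrict (Ioc τ₀ τ₁)) :=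
    (hmA.mul (hmD2.aemeasurable.pow_const _)).const_mul _
  rw [lintegral_add_left' m1, lintegral_const_mul' _ _ hCSfin, lintegral_const_mul' _ _ hlamfin]
  have hCS1 := lintegral_mul_rpow_half_le (μ := volume.restrict (Ioc τ₀ τ₁)) hmA hmD2.aemeasurable
  have hCS2 := lintegral_mul_rpow_half_le (μ := volume.restrict (Ioc τ₀ τ₁)) hmA hmD.aemeasurable
  have hA2 : (∫⁻ τ in Ioc τ₀ τ₁, ((∫⁻ x, ‖u τ x - v τ x‖ₑ ^ (2 : ℝ)) ^ (1 / 2 : ℝ)) ^ (2 : ℝ)) =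
      ∫⁻ τ in Ioc τ₀ τ₁, ∫⁻ x, ‖u τ x - v τ x‖ₑ ^ (2 : ℝ) := by
    refine lintegral_congr fun τ => ?_
    rw [← ENNReal.rpow_mul]; norm_num
  rw [hA2] at hCS1 hCS2
  have hE1 := hΘ.setLIntegral_sum_frobenius_fderiv_fderiv_heatDuhamelBack_le hν hab hτ hb
  have hE0 := hΘ.setLIntegral_frobenius_fderiv_heatDuhamelBack_le hν hab hτ hb
  have hsplit1 : ENNReal.ofReal ((Module.finrank ℝ E : ℝ) / ν ^ 2 * ∫ s in τ₀..τ₁, ∫ x, ‖Θ s x‖ ^ 2) ^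
      (1 / 2 : ℝ) = ENNReal.ofReal ((Module.finrank ℝ E : ℝ) / ν ^ 2) ^ (1 / 2 : ℝ) *
        ENNReal.ofReal (∫ s in τ₀..τ₁, ∫ x, ‖Θ s x‖ ^ 2) ^ (1 / 2 : ℝ) := by
    rw [ENNReal.ofReal_mul (by positivity), ENNReal.mul_rpow_of_nonneg _ _ (by norm_num)]
  have hsplit0 : ENNReal.ofReal (2 * (τ₁ - τ₀) / ν * ∫ s in τ₀..τ₁, ∫ x, ‖Θ s x‖ ^ 2) ^
      (1 / 2 : ℝ) = ENNReal.ofReal (2 * (τ₁ - τ₀) / ν) ^ (1 / 2 : ℝ) *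
        ENNReal.ofReal (∫ s in τ₀..τ₁, ∫ x, ‖Θ s x‖ ^ 2) ^ (1 / 2 : ℝ) := by
    have h0 : 0 ≤ 2 * (τ₁ - τ₀) / ν := by
      have := sub_nonneg.2 hτ
      positivity
    rw [ENNReal.ofReal_mul h0, ENNReal.mul_rpow_of_nonneg _ _ (by norm_num)]
  calc (eps + eps : ℝ≥0∞) * ((Module.finrank ℝ E : ℝ≥0∞) * (SNormLESNormFDerivOfEqConst E (volume : Measure E) 2 : ℝ≥0)) * (∫⁻ τ in Ioc τ₀ τ₁, (∫⁻ x, ‖u τ x - v τ x‖ₑ ^ (2 : ℝ)) ^ (1 / 2 : ℝ) * (∑ i, ∫⁻ x, ENNReal.ofReal (frobeniusNormSq (fderiv ℝ (fun y => fderiv ℝ (heatDuhamelBack ν Θ τ) y (stdOrthonormalBasis ℝ E i)) x))) ^ (1 / 2 : ℝ)) +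
        2 * lam * (∫⁻ τ in Ioc τ₀ τ₁, (∫⁻ x, ‖u τ x - v τ x‖ₑ ^ (2 : ℝ)) ^ (1 / 2 : ℝ) * (∫⁻ x, ENNReal.ofReal (frobeniusNormSq (fderiv ℝ (heatDuhamelBack ν Θ τ) x))) ^ (1 / 2 : ℝ))
      ≤ (eps + eps : ℝ≥0∞) * ((Module.finrank ℝ E : ℝ≥0∞) * (SNormLESNormFDerivOfEqConst E (volume : Measure E) 2 : ℝ≥0)) *
          ((∫⁻ τ in Ioc τ₀ τ₁, ∫⁻ x, ‖u τ x - v τ x‖ₑ ^ (2 : ℝ)) ^ (1 / 2 : ℝ) *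
            (∫⁻ τ in Ioc τ₀ τ₁, (∑ i, ∫⁻ x, ENNReal.ofReal (frobeniusNormSq (fderiv ℝ (fun y => fderiv ℝ (heatDuhamelBack ν Θ τ) y (stdOrthonormalBasis ℝ E i)) x)))) ^ (1 / 2 : ℝ)) +
        2 * lam * ((∫⁻ τ in Ioc τ₀ τ₁, ∫⁻ x, ‖u τ x - v τ x‖ₑ ^ (2 : ℝ)) ^ (1 / 2 : ℝ) *
            (∫⁻ τ in Ioc τ₀ τ₁, (∫⁻ x, ENNReal.ofReal (frobeniusNormSq (fderiv ℝ (heatDuhamelBack ν Θ τ) x)))) ^ (1 / 2 : ℝ)) := by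
        gcongr
    _ ≤ (eps + eps : ℝ≥0∞) * ((Module.finrank ℝ E : ℝ≥0∞) * (SNormLESNormFDerivOfEqConst E (volume : Measure E) 2 : ℝ≥0)) *
          ((∫⁻ τ in Ioc τ₀ τ₁, ∫⁻ x, ‖u τ x - v τ x‖ₑ ^ (2 : ℝ)) ^ (1 / 2 : ℝ) *
            ENNReal.ofReal ((Module.finrank ℝ E : ℝ) / ν ^ 2 *
              ∫ s in τ₀..τ₁, ∫ x, ‖Θ s x‖ ^ 2) ^ (1 / 2 : ℝ)) +
        2 * lam * ((∫⁻ τ in Ioc τ₀ τ₁, ∫⁻ x, ‖u τ x - v τ x‖ₑ ^ (2 : ℝ)) ^ (1 / 2 : ℝ) *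
            ENNReal.ofReal (2 * (τ₁ - τ₀) / ν * ∫ s in τ₀..τ₁, ∫ x, ‖Θ s x‖ ^ 2) ^ (1 / 2 : ℝ)) := by
        gcongr
    _ = _ := by
        rw [hsplit1, hsplit0, two_mul (eps : ℝ≥0∞)]
        ring

end Estimate


end Literature.Analysis.FluidPDE
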